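import Summits.CriticalPhenomena.PercolationContinuityZ3.Theorems.PercNearOneGluingNoHeavyLowerTailSunflowerBoxEvents
import Summits.CriticalPhenomena.PercolationContinuityZ3.Theorems.PercNearOneGluingNoHeavyLowerTailSunflowerTwoGeneratorCore
import HarnessLib

/-!
# `NoHeavyLowerTail` (crux stmt-CriticalPhenomena-4575), abstract sunflower cubic: the GENERAL BOX LEMMA — for pairwise disjoint sets
# `U_i` of points of a product of blocks, `∏_i P(all missing points lie in U_i) ≤ P(no missing point)^(K−1)`

Support file (seat `prim-ineq-prove-1` gen 34; `--supports stmt-CriticalPhenomena-4575`).  No `sorry`, no named facts.  Memo: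
run/shared/lean/prim/prim-ineq-prove-1/FINDING-PRINCIPALCORE-prove1-g34.md §3 (BOX LEMMA, any number `r` of blocks).  Inputs: the
K-decreasing-functions lemma (`…SunflowerKDecreasing`), box events and their peeling law (`…SunflowerBoxEvents`), counting lemmas
(`…SunflowerTwoGeneratorCore`).

* **`prod_zeta_le_pow`** — THE BOX LEMMA: if the `U_i ∩ piFinset D` are pairwise disjoint (and inactive domains are nonempty) then
  `∏_i zeta B D (U i) ≤ (zeta B D ∅)^(|κ|−1)`.  Induction on the set `B` of active blocks; the step is `KDecreasing.prod_Ex_le_of_antitone'`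
  applied to the antitone functions `T ↦ zeta B (update D k₀ T) (U i) ∈ [c, 1]`, `c = P(some active block fully present)`, whose product
  at `T ≠ ∅` is `≤ c^(K−1)` by the induction hypothesis; a vanishing `c` (some active block has a sure coordinate, or no active block is
  left) is handled directly by the one-block counting bound `TwoGenCore.prod_prod_sdiff_le_pow`.
USE: `…SunflowerDeltaCore` — Lemma A `∏ μ(V_i) ≤ μ(A)^(K−1)` for every sunflower whose core has Δ-system minimal elements.
-/

noncomputable section

namespace Summit.CriticalPhenomena.PercolationContinuityZ3.Theorems.SunflowerPartition

namespace BoxLemma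

open MeasureTheory Finset
open Literature.Probability.LatticeModels Literature.Probability.Percolation TwoGenCore

variable {ι : Type*} [DecidableEq ι] {β : Type*} [Fintype β] [DecidableEq β] [Fintype ι]

/-! ## The box lemma -/

/-- **THE BOX LEMMA** (memo §3).  Blocks with pairwise disjoint domains, nonempty inactive domains, and targets `U i` pairwise disjoint on
the grid: `∏_i zeta p B D (U i) ≤ (zeta p B D ∅)^(|κ|−1)`. [this work] -/
theorem prod_zeta_le_pow {κ : Type*} [Fintype κ] (p : ι → unitInterval) (B : Finset β) :
    ∀ (D : β → Finset ι), (∀ k l, k ≠ l → Disjoint (D k) (D l)) → (∀ k, k ∉ B → (D k).Nonempty) →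
      ∀ (U : κ → Finset (β → ι)), (∀ i j, i ≠ j → ∀ v ∈ Fintype.piFinset D, v ∈ U i → v ∉ U j) →
        ∏ i, zeta p B D (U i) ≤ (zeta p B D ∅) ^ (Fintype.card κ - 1) := by
  classical
  induction B using Finset.induction_on with
  | empty =>
    intro D _ hD U hU
    rw [Finset.prod_congr rfl (fun i _ => zeta_empty_active p D (U i)), zeta_empty_active p D ∅]
    by_cases hne : (Fintype.piFinset D).Nonempty
    · obtain ⟨v₀, hv₀⟩ := hne
      have h0 : ¬ ∀ v ∈ Fintype.piFinset D, v ∈ (∅ : Finset (β → ι)) := fun h => Finset.notMem_empty _ (h v₀ hv₀)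
      rw [if_neg h0]
      -- at most one `U i` contains the whole grid
      rcases Nat.lt_or_ge (Fintype.card κ) 2 with hK | hK
      · have hle : ∏ i, (if ∀ v ∈ Fintype.piFinset D, v ∈ U i then (1 : ℝ) else 0) ≤ 1 :=
          Finset.prod_le_one (fun i _ => by split_ifs <;> norm_num) fun i _ => by split_ifs <;> norm_num
        have : Fintype.card κ - 1 = 0 := by omega
        rw [this, pow_zero]; exact hle
      · obtain ⟨i, -, j, -, hij⟩ := Finset.one_lt_card.1 (by rw [Finset.card_univ]; omega : 1 < (Finset.univ : Finset κ).card)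
        have : (∏ i, (if ∀ v ∈ Fintype.piFinset D, v ∈ U i then (1 : ℝ) else 0)) = 0 := by
          by_cases hi : ∀ v ∈ Fintype.piFinset D, v ∈ U i
          · exact Finset.prod_eq_zero (Finset.mem_univ j) (if_neg fun hj => hU i j hij v₀ hv₀ (hi v₀ hv₀) (hj v₀ hv₀))
          · exact Finset.prod_eq_zero (Finset.mem_univ i) (if_neg hi)
        rw [this]
        exact pow_nonneg le_rfl _
    · rw [Finset.not_nonempty_iff_eq_empty] at hne
      have h1 : ∀ (W : Finset (β → ι)), (∀ v ∈ Fintype.piFinset D, v ∈ W) := fun W v hv => by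
        rw [hne] at hv; exact absurd hv (Finset.notMem_empty v)
      rw [Finset.prod_eq_one (fun i _ => if_pos (h1 (U i))), if_pos (h1 ∅), one_pow]
  | @insert k₀ B hk₀ ih =>
    intro D hdisj hD U hU
    set K := Fintype.card κ with hK
    have hq : ∀ e, 0 ≤ ((p e : unitInterval) : ℝ) ∧ ((p e : unitInterval) : ℝ) ≤ 1 := fun e => ⟨(p e).2.1, (p e).2.2⟩
    -- inactive domains after peeling
    have hD' : ∀ (T : Finset ι), T.Nonempty → ∀ k, k ∉ B → (Function.update D k₀ T k).Nonempty := by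
      intro T hT k hk
      by_cases hk' : k = k₀
      · subst hk'; rwa [Function.update_self]
      · rw [Function.update_of_ne hk']; exact hD k (by rw [Finset.mem_insert]; tauto)
    have hdisjT : ∀ (T : Finset ι), T ⊆ D k₀ → ∀ k l, k ≠ l → Disjoint (Function.update D k₀ T k) (Function.update D k₀ T l) := by
      intro T hT k l hkl
      by_cases hk : k = k₀
      · subst hk; rw [Function.update_self, Function.update_of_ne (Ne.symm hkl)]
        exact (hdisj k l hkl).mono_left hT
      · by_cases hl : l = k₀
        · subst hl; rw [Function.update_self, Function.update_of_ne hk]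
          exact (hdisj k l hkl).mono_right hT
        · rw [Function.update_of_ne hk, Function.update_of_ne hl]; exact hdisj k l hkl
    have hUT : ∀ (T : Finset ι), T ⊆ D k₀ → ∀ i j, i ≠ j → ∀ v ∈ Fintype.piFinset (Function.update D k₀ T), v ∈ U i → v ∉ U j := by
      intro T hT i j hij v hv
      rw [Fintype.piFinset_update_eq_filter_piFinset_mem D k₀ hT, Finset.mem_filter] at hv
      exact hU i j hij v hv.1
    -- the constant `c`
    set c := (prodBernoulli p).real {ω : Set ι | ∃ k ∈ B, ∀ e ∈ D k, e ∈ ω} with hc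
    have hzeta_empty : ∀ (T : Finset ι), T.Nonempty → zeta p B (Function.update D k₀ T) ∅ = c := by
      intro T hT
      unfold zeta
      rw [Box_emptyset_eq (hD' T hT)]
      congr 1
      ext ω
      simp only [Set.mem_setOf_eq]
      refine exists_congr fun k => and_congr_right fun hk => ?_
      rw [Function.update_of_ne (ne_of_mem_of_not_mem hk hk₀)]
    have hc0 : 0 ≤ c := measureReal_nonneg
    have hc1 : c ≤ 1 := measureReal_le_one
    set P₁ := ∏ e ∈ D k₀, (p e : ℝ) with hP₁
    -- the functions `G i T = zeta B (D[k₀ ↦ T]) (U i)`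
    have hG_le : ∀ i (T : Finset ι), zeta p B (Function.update D k₀ T) (U i) ≤ 1 := fun i T => measureReal_le_one
    have hG_ge : ∀ i (T : Finset ι), T ⊆ D k₀ → c ≤ zeta p B (Function.update D k₀ T) (U i) := by
      intro i T hT
      rcases T.eq_empty_or_nonempty with hT0 | hTn
      · rw [hT0]; unfold zeta; rw [Box_update_empty, probReal_univ]; exact hc1
      · rw [← hzeta_empty T hTn]
        exact measureReal_mono (Box_mono fun v _ hv => absurd hv (Finset.notMem_empty v))
    have hG_anti : ∀ i (T T' : Finset ι), T ⊆ T' → zeta p B (Function.update D k₀ T') (U i) ≤ zeta p B (Function.update D k₀ T) (U i) :=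
      fun i T T' hTT' => measureReal_mono (Box_update_anti hTT' (U i))
    have hG_prod : ∀ (T : Finset ι), T ⊆ D k₀ → T.Nonempty →
        ∏ i, zeta p B (Function.update D k₀ T) (U i) ≤ c ^ (K - 1) := by
      intro T hT hTn
      rw [← hzeta_empty T hTn]
      exact ih _ (hdisjT T hT) (hD' T hTn) U (hUT T hT)
    -- target value
    have htarget : zeta p (insert k₀ B) D ∅ = P₁ + (1 - P₁) * c := by
      rw [zeta_insert p hk₀ hdisj]
      have hsplit : ∀ T ∈ (D k₀).powerset, wmiss p (D k₀) T * zeta p B (Function.update D k₀ T) ∅ =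
          wmiss p (D k₀) T * (if T = ∅ then 1 else c) := by
        intro T hT
        split_ifs with h0
        · rw [h0]; unfold zeta; rw [Box_update_empty, probReal_univ]
        · rw [hzeta_empty T (Finset.nonempty_iff_ne_empty.2 h0)]
      rw [Finset.sum_congr rfl hsplit]
      have hsum : ∑ T ∈ (D k₀).powerset, wmiss p (D k₀) T = 1 := by
        rw [sum_wmiss_subset p (subset_refl (D k₀)), Finset.sdiff_self]; simp
      have hempty : wmiss p (D k₀) ∅ = P₁ := by simp [wmiss, hP₁]
      rw [← Finset.add_sum_erase _ _ (Finset.empty_mem_powerset (D k₀)), if_pos rfl, hempty, mul_one]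
      have : ∑ T ∈ (D k₀).powerset.erase ∅, wmiss p (D k₀) T * (if T = ∅ then 1 else c) =
          c * ∑ T ∈ (D k₀).powerset.erase ∅, wmiss p (D k₀) T := by
        rw [Finset.mul_sum]
        refine Finset.sum_congr rfl fun T hT => ?_
        rw [if_neg (Finset.ne_of_mem_erase hT)]; ring
      rw [this]
      have herase : ∑ T ∈ (D k₀).powerset.erase ∅, wmiss p (D k₀) T = 1 - P₁ := by
        have := Finset.add_sum_erase _ (fun T => wmiss p (D k₀) T) (Finset.empty_mem_powerset (D k₀))
        rw [hsum, hempty] at this; linarith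
      rw [herase]; ring
    rw [htarget]
    -- the products of the `zeta (insert k₀ B) D (U i)` as expectations
    rcases eq_or_lt_of_le hc0 with hc00 | hcpos
    · -- degenerate case `c = 0`: every active block has a surely-absent coordinate
      have hnull : ∀ k ∈ B, (prodBernoulli p).real {ω : Set ι | ∀ e ∈ D k, e ∈ ω} = 0 := by
        intro k hk
        refine le_antisymm ?_ measureReal_nonneg
        rw [hc00]
        exact measureReal_mono fun ω hω => ⟨k, hk, hω⟩
      have hzero : ∀ k ∈ B, ∃ f ∈ D k, (p f : ℝ) = 0 := by
        intro k hk
        have h := hnull k hk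
        rw [show {ω : Set ι | ∀ e ∈ D k, e ∈ ω} = {ω | ((D k : Finset ι) : Set ι) ⊆ ω} from by
          ext ω; simp [Set.subset_def], prodBernoulli_real_subset] at h
        exact Finset.prod_eq_zero_iff.1 h
      have fspec : ∀ k (hk : k ∈ B), ∃ f, f ∈ D k ∧ (p f : ℝ) = 0 := fun k hk => by
        obtain ⟨f, hf, hpf⟩ := hzero k hk; exact ⟨f, hf, hpf⟩
      let fk : ∀ k, k ∈ B → ι := fun k hk => Classical.choose (fspec k hk)
      have hfk : ∀ k (hk : k ∈ B), fk k hk ∈ D k ∧ (p (fk k hk) : ℝ) = 0 := fun k hk => Classical.choose_spec (fspec k hk)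
      have hnot : ∀ k, k ≠ k₀ → k ∉ B → k ∉ insert k₀ B := fun k h1 h2 => by
        rw [Finset.mem_insert]; tauto
      -- the point with `k₀`-coordinate `t`, active coordinates `fk k`, inactive coordinates from the nonempty domains
      let pt : ι → β → ι := fun t k =>
        if h : k = k₀ then t else if hk : k ∈ B then fk k hk else (hD k (hnot k h hk)).choose
      have hpt_k₀ : ∀ t, pt t k₀ = t := fun t => by simp [pt]
      have hpt_B : ∀ t k (hk : k ∈ B), pt t k = fk k hk := fun t k hk => by
        have hk' : k ≠ k₀ := ne_of_mem_of_not_mem hk hk₀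
        simp [pt, hk', hk]
      have hpt : ∀ t ∈ D k₀, pt t ∈ Fintype.piFinset D := by
        intro t ht
        rw [Fintype.mem_piFinset]
        intro k
        by_cases hk : k = k₀
        · subst hk; rw [hpt_k₀]; exact ht
        · by_cases hkB : k ∈ B
          · rw [hpt_B t k hkB]; exact (hfk k hkB).1
          · simp only [pt, hk, hkB, ↓reduceDIte]
            exact (hD k (hnot k hk hkB)).choose_spec
      let W : κ → Finset ι := fun i => (D k₀).filter fun t => pt t ∈ U i
      have hWsub : ∀ i, W i ⊆ D k₀ := fun i => Finset.filter_subset _ _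
      have hWd : ∀ i j, i ≠ j → Disjoint (W i) (W j) := by
        intro i j hij
        rw [Finset.disjoint_left]
        intro t hti htj
        rw [Finset.mem_filter] at hti htj
        exact hU i j hij (pt t) (hpt t hti.1) hti.2 htj.2
      -- on a full-measure set, `Box B (D[k₀↦T]) (U i)` forces `T ⊆ W i`
      have hGle : ∀ i (T : Finset ι), T ⊆ D k₀ → zeta p B (Function.update D k₀ T) (U i) ≤ if T ⊆ W i then 1 else 0 := by
        intro i T hT
        split_ifs with hTW
        · exact measureReal_le_one
        · obtain ⟨t, htT, htW⟩ := Finset.not_subset.1 hTW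
          have htW' : pt t ∉ U i := fun h => htW (Finset.mem_filter.2 ⟨hT htT, h⟩)
          -- the box event is contained in the null event "some `f k` is present"
          have hsub : Box B (Function.update D k₀ T) (U i) ⊆ ⋃ k ∈ B.attach, {ω : Set ι | fk k.1 k.2 ∈ ω} := by
            intro ω hω
            by_contra hcon
            apply htW'
            refine hω (pt t) ?_ fun k hk => ?_
            · rw [Fintype.piFinset_update_eq_filter_piFinset_mem D k₀ hT, Finset.mem_filter]
              exact ⟨hpt t (hT htT), by rw [hpt_k₀]; exact htT⟩
            · rw [hpt_B t k hk]
              exact fun h => hcon (Set.mem_iUnion₂.2 ⟨⟨k, hk⟩, Finset.mem_attach _ _, h⟩)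
          calc zeta p B (Function.update D k₀ T) (U i) ≤ (prodBernoulli p).real (⋃ k ∈ B.attach, {ω : Set ι | fk k.1 k.2 ∈ ω}) :=
                measureReal_mono hsub (measure_ne_top _ _)
            _ ≤ ∑ k ∈ B.attach, (prodBernoulli p).real {ω : Set ι | fk k.1 k.2 ∈ ω} :=
                measureReal_biUnion_finset_le _ _
            _ = 0 := Finset.sum_eq_zero fun k _ => by rw [prodBernoulli_real_setOf_mem, (hfk k.1 k.2).2]
      have hEx : ∀ i, zeta p (insert k₀ B) D (U i) ≤ ∏ e ∈ D k₀ \ W i, (p e : ℝ) := by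
        intro i
        rw [zeta_insert p hk₀ hdisj]
        have hwm : ∀ T, 0 ≤ wmiss p (D k₀) T := fun T =>
          mul_nonneg (Finset.prod_nonneg fun e _ => by linarith [(hq e).2]) (Finset.prod_nonneg fun e _ => (hq e).1)
        calc ∑ T ∈ (D k₀).powerset, wmiss p (D k₀) T * zeta p B (Function.update D k₀ T) (U i)
            ≤ ∑ T ∈ (D k₀).powerset, wmiss p (D k₀) T * (if T ⊆ W i then 1 else 0) :=
              Finset.sum_le_sum fun T hT => mul_le_mul_of_nonneg_left (hGle i T (Finset.mem_powerset.1 hT)) (hwm T)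
          _ = ∑ T ∈ (W i).powerset, wmiss p (D k₀) T := by
              rw [← Finset.sum_subset (Finset.powerset_mono.2 (hWsub i))]
              · refine Finset.sum_congr rfl fun T hT => ?_
                rw [if_pos (Finset.mem_powerset.1 hT), mul_one]
              · intro T _ hT
                rw [Finset.mem_powerset] at hT
                rw [if_neg hT, mul_zero]
          _ = ∏ e ∈ D k₀ \ W i, (p e : ℝ) := sum_wmiss_subset p (hWsub i)
      calc ∏ i, zeta p (insert k₀ B) D (U i) ≤ ∏ i, ∏ e ∈ D k₀ \ W i, (p e : ℝ) :=
            Finset.prod_le_prod (fun i _ => measureReal_nonneg) fun i _ => hEx i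
        _ ≤ P₁ ^ (K - 1) := prod_prod_sdiff_le_pow (D k₀) hq W hWd
        _ = (P₁ + (1 - P₁) * c) ^ (K - 1) := by rw [← hc00]; ring
    · -- main case: the K-decreasing-functions lemma on the subtype of `D k₀`
      set a := D k₀ with ha
      let emb := Function.Embedding.subtype (· ∈ a)
      let G : κ → Finset ↥a → ℝ := fun i S => zeta p B (Function.update D k₀ (S.map emb)) (U i)
      have hmapsub : ∀ S : Finset ↥a, S.map emb ⊆ a := by
        intro S e he
        rw [Finset.mem_map] at he
        obtain ⟨x, _, rfl⟩ := he
        exact x.2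
      have hq' : ∀ x : ↥a, 0 ≤ ((p x : unitInterval) : ℝ) ∧ ((p x : unitInterval) : ℝ) ≤ 1 := fun x => hq x
      have key := KDecreasing.prod_Ex_le_of_antitone' (g := ↥a) (Finset.univ : Finset κ) hq' hcpos hc1 G
        (fun i _ S T hST => hG_anti i _ _ (Finset.map_subset_map.2 hST))
        (fun i _ S => hG_ge i _ (hmapsub S)) (fun i _ S => hG_le i _) ?_
      · have hP1 : ∏ x : ↥a, ((p x : unitInterval) : ℝ) = P₁ := Finset.prod_coe_sort a (fun e => ((p e : unitInterval) : ℝ))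
        rw [hP1, Finset.card_univ] at key
        -- identify `zeta (insert k₀ B) D (U i)` with the expectation of `G i`
        have hEx : ∀ i, zeta p (insert k₀ B) D (U i) = KDecreasing.Ex (g := ↥a) (fun x => (p x : ℝ)) (G i) := by
          intro i
          rw [zeta_insert p hk₀ hdisj]
          -- reindex the sum over `a.powerset` by `Finset ↥a` (same computation as `TwoGenCore.box_eq_Ex`)
          unfold KDecreasing.Ex
          symm
          refine Finset.sum_bij (fun S _ => S.map emb) (fun S _ => Finset.mem_powerset.2 (hmapsub S))
            (fun S _ S' _ h => Finset.map_injective _ h) (fun T hT => ?_) (fun S _ => ?_)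
          · refine ⟨T.subtype (· ∈ a), Finset.mem_univ _, ?_⟩
            rw [Finset.mem_powerset] at hT
            exact Finset.subtype_map_of_mem fun x hx => hT hx
          · congr 1
            unfold KDecreasing.wt wmiss
            set T := S.map emb with hT
            have h1 : (∏ x : ↥a, if x ∈ S then 1 - ((p x : unitInterval) : ℝ) else ((p x : unitInterval) : ℝ)) =
                ∏ e ∈ a, (if e ∈ T then 1 - (p e : ℝ) else (p e : ℝ)) := by
              rw [← Finset.prod_coe_sort a (fun e => if e ∈ T then 1 - (p e : ℝ) else (p e : ℝ))]
              refine Finset.prod_congr rfl fun x _ => ?_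
              have hx : ((x : ι) ∈ T) ↔ x ∈ S := by rw [hT]; exact Finset.mem_map' _
              by_cases hxS : x ∈ S
              · rw [if_pos hxS, if_pos (hx.2 hxS)]
              · rw [if_neg hxS, if_neg (fun h => hxS (hx.1 h))]
            rw [h1, Finset.prod_ite, Finset.filter_mem_eq_inter, Finset.inter_eq_right.2 (hmapsub S), Finset.filter_not,
              Finset.filter_mem_eq_inter, Finset.inter_eq_right.2 (hmapsub S)]
        calc ∏ i, zeta p (insert k₀ B) D (U i) = ∏ i, KDecreasing.Ex (g := ↥a) (fun x => (p x : ℝ)) (G i) :=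
              Finset.prod_congr rfl fun i _ => hEx i
          _ ≤ (P₁ + (1 - P₁) * c) ^ (K - 1) := key
      · intro S hS
        rw [Finset.card_univ]
        have hSn : (S.map emb).Nonempty := by
          obtain ⟨x, hx⟩ := hS; exact ⟨emb x, Finset.mem_map_of_mem _ hx⟩
        exact hG_prod _ (hmapsub S) hSn

end BoxLemma

end Summit.CriticalPhenomena.PercolationContinuityZ3.Theorems.SunflowerPartition
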